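import Summits.QuantumFields.YangMills.Theorems.BalabanUVNodesN18AtReadingOfRecord13
import Literature.MathematicalPhysics.QuantumFieldTheory.Balaban1983to89.Node00.HistoryRecursionOfRecord

/-!
# BalabanUVNodes ∕ node N18 = NE5 — N18 AT THE STAGE-13 HOMES FOR THE RUN TOWERS `runTowers S′`: the statement of record compares the runs' terms at the
# creation steps `j ≤ k` only — per tuple, at the unguarded home and at the regime-restricted home
# (Track A, DAG node N18 = `T4OutputRate.NE5` :211; cluster K4 «SpineRates», item K3⁗ `SpineGivenEndpointR13Sep` ∕ K3‴; module 18f of seat pub-ymgap-dag-n18-d, strategy s2)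

HONEST FRAMING.  Count-neutral kernel bookkeeping (`--supports … --as helper`), composition BY NAME of landed theorems; NE5 is NOT PRINTED and NOT proved;
N18 is NOT discharged; no inhabitant of `IsDatumOfRecord₁₃C` is claimed (K0 OPEN); the towers `S′` stay a PARAMETER.

WHY.  [I] (0.23)–(0.24): the run of `k` renormalization steps on the `k`-th torus creates the terms of creation steps `j = 1, …, k` and no others; node00-def-W1's
`Node00/HistoryRecursionOfRecord` §1 types this as `runTowers S′ k := truncRun k (S′ k)` (steps `m < k` kept, steps `m ≥ k` TERMLESS) with
`functionalC_truncRun_of_le` ∕ `functionalC_truncRun_eq_zero`.  Module 17 (`…N18AtRunTowers`, p494645) read N18's ₁₂ statement of record at the run towers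
(«⇔ the creation steps `j ≤ k` of the untruncated towers»); modules 18 ∕ 18b typed the Stage-13 homes for any pinned reading; dag-n27-c's XLII and dag-n22-e's
8b″ read the admissible Stage-13 reading AT RUN TOWERS (`runTowers (k ↦ toClusterTower (G F θ k))`).  THIS FILE is module 17 §1 at the Stage-13 homes: per tuple
and run length (§1: `N18At` at the Stage-13 bundle of `ReadingData.ofRecordAdm … (runTowers S′) …` ⇔ the η-rate inequality for the UNTRUNCATED towers `S′ k ∕ S′
(k+1)` at the run-A domains of creation step `j ≤ k`, under the sign letters `0 ≤ C₅`, `0 ≤ θ₅` — the domains of creation step `j > k` compare `0` with `0`),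
and the closed forms of `S_N18 (RRec₁₃ 𝔯)` ∕ `S_N18 (RRec₁₃On 𝔯 Rg)` for any reading pinned to that family (§2: module 18's `s_N18_rRec₁₃_iff_of_pin` route and
layer B's `s_N18_rRec₁₃On_iff` + §1) — `k + 1` levels per run length, the honest display of what the statement at the run towers asks.

WHAT (all `theorem`, 0 `def`).  §1 `n18At_u3OfRecord₁₃_readingAdm_runTowers_iff_le`.  §2 ★ `s_N18_rRec₁₃_readingAdm_runTowers_iff_le_of_pin` (unguarded home),
★ `s_N18_rRec₁₃On_readingAdm_runTowers_iff_le_of_pin` (regime home).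

One finite four-torus programme at fixed `ε`; NOT the continuum limit, NOT OS, NOT a mass gap, NOT Clay.  0 `def`, 0 `sorry`.  Sources (TYPES only): T. Bałaban,
CMP **109** (1987) [Balaban1987RG1] (0.23)–(0.25) pp. 256–257, Thm 1 p. 259, (1.18) p. 263; CMP **116** (1988) [Balaban1988RG2Cluster] (2.13) p. 14, (2.16)–(2.18)
p. 16; CMP **122** (1989) [Balaban1989LargeFieldII] (the record's stage).
-/

noncomputable section

open Set Metric
open scoped Matrix.Norms.L2Operator

namespace YMDAG.N18.W1Reading

open Literature.MathematicalPhysics.QuantumFieldTheory.Balaban1983to89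
open Literature.MathematicalPhysics.QuantumFieldTheory.Balaban1983to89.T4Continuum
open Literature.MathematicalPhysics.QuantumFieldTheory.Balaban1983to89.T4OutputRate (Carriers Functional NE5 DecayBound Window)
open Literature.MathematicalPhysics.QuantumFieldTheory.Balaban1983to89.Node00 (Stage12Params Stage13Params IsDatumOfRecord₁₃C datumOfRecord₁₃ U3Letters₁₁
  U3Objects₁₁ NE2Objects₁₁ NE3Letters₁₁ prependCoupling MatA ιSU avOfRecord)
open Literature.MathematicalPhysics.QuantumFieldTheory.Balaban1983to89.Node00.Sect2 (domCount domSys CPair ofBackgroundC)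
open Literature.MathematicalPhysics.QuantumFieldTheory.Balaban1983to89.Node00.W1 (ReadingData LevelPairing LetterInputs ClusterTower pairOfRecord
  dj_pairOfRecord functionalC functional box SpRestr truncRun runTowers termlessTower functionalC_truncRun_of_le functionalC_truncRun_eq_zero)
open Summit.QuantumFields.BalabanUV.T4Continuum.B13Carriers (transportRaw)
open Summit.QuantumFields.BalabanUV.T4Continuum.Spine.NE5
open YMDAG.N18.HLayer
open YMDAG.UVSplit

variable {N : ℕ} [NeZero N]

/-! ## §1 Per tuple and run length: the run towers below and beyond the run length -/

section Faces

variable {F : T4Family} (θ : Stage13Params F N) (k : ℕ)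

/-- **AT THE RUN TOWERS, N18 AT LEVEL `k` ⇔ THE η-RATE INEQUALITY FOR THE UNTRUNCATED TOWERS AT THE CREATION STEPS `j ≤ k`** [bookkeeping; module 18 §1's
closed form `n18At_u3OfRecord₁₃_readingAdm_iff` at `S := runTowers S′` + W1's `functionalC_truncRun_of_le` ∕ `functionalC_truncRun_eq_zero`]: for the objects of
`ReadingData.ofRecordAdm F θ.τ9.M N (runTowers S′) sp gauge hg T₀ hT₀ li`, under the sign letters `0 ≤ C₅`, `0 ≤ θ₅` (the run-A domains of creation step
`j > k` compare `0` with `0`: run A creates no term after step `k`, run B none after step `k + 1` and the paired domain has creation step `j + 1 > k + 1`):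
`N18At` at level `k` ⇔ for every member `b ∈ ]0, θ.γ]`, history `g ∈ ]0, θ.γ]^ℕ`, ADMISSIBLE run-B field `U` and every run-A domain `(j, X)` WITH `j ≤ k`,
`|Re E^{(j)}_{S′_k}(X; g; (ι(T₀ U), 0)) − Re E^{(j+1)}_{S′_{k+1}}(πX; b∷g; (ιU, 0))| ≤ C₅ · θ₅ ^ j · e^{−κ·d_j(X)}` — `k + 1` levels per run length.  The per-tuple
form of module 17 §1 at a Stage-13 tuple.  NOT PRINTED; NOT proved. [cite: Balaban1987RG1, (0.23)–(0.25) pp.256–257, Thm 1 p.259 and (1.18) p.263; Balaban1988RG2Cluster, (2.13) p.14 and (2.16)–(2.18) p.16] -/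
theorem n18At_u3OfRecord₁₃_readingAdm_runTowers_iff_le (S' : (k : ℕ) → ClusterTower (F.P k) (MatA N) θ.τ9.M)
    (sp : (k j : ℕ) → (domSys (F.P k) θ.τ9.M j).Dom → Set (CPair (F.P k) (MatA N)))
    (gauge : (k : ℕ) → GaugeField (F.P k) 0 (Node00.SU N) → GaugeField (F.P k) 0 (Node00.SU N) → ℝ) (hg : ∀ k U U', 0 ≤ gauge k U U')
    (T₀ : (k : ℕ) → GaugeField (F.P (k + 1)) 0 (Node00.SU N) → GaugeField (F.P k) 0 (Node00.SU N))
    (hT₀ : ∀ (k : ℕ) (U : GaugeField (F.P (k + 1)) 0 (Node00.SU N)),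
      (∀ (j : ℕ) (Y : (domSys (F.P (k + 1)) θ.τ9.M j).Dom), ofBackgroundC (ιSU N) U ∈ sp (k + 1) j Y) →
        ∀ (j : ℕ) (X : (domSys (F.P k) θ.τ9.M j).Dom), ofBackgroundC (ιSU N) (T₀ k U) ∈ sp k j X)
    (li : LetterInputs) (hC₅ : 0 ≤ li.C₅) (hθ₅ : 0 ≤ li.θ₅) :
    N18At (u3OfRecord₁₃ θ ((ReadingData.ofRecordAdm F θ.τ9.M N (runTowers S') sp gauge hg T₀ hT₀ li).u3Objects θ.γ) k) ↔
      ∀ b : ℝ, 0 < b → b ≤ θ.γ → ∀ g ∈ Window θ.γ,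
        ∀ (U : {U : GaugeField (F.P (k + 1)) 0 (Node00.SU N) // ∀ (j : ℕ) (Y : (domSys (F.P (k + 1)) θ.τ9.M j).Dom), ofBackgroundC (ιSU N) U ∈ sp (k + 1) j Y})
          (X : Node00.W1.Dom (F.P k) θ.τ9.M), X.1 ≤ k →
        |(functionalC (S' k) g (ofBackgroundC (ιSU N) (T₀ k U.1)) X).re -
            (functionalC (S' (k + 1)) (prependCoupling b g) (ofBackgroundC (ιSU N) U.1) (pairOfRecord F θ.τ9.M k X)).re| ≤
          li.C₅ * li.θ₅ ^ X.1 * Real.exp (-(li.κ * (domSys (F.P k) θ.τ9.M X.1).dj X.2)) := by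
  rw [n18At_u3OfRecord₁₃_readingAdm_iff]
  refine forall₃_congr fun b _ _ => forall₂_congr fun g _ => forall_congr' fun U => ⟨fun H X hX => ?_, fun H X => ?_⟩
  · have hA : (functionalC (runTowers S' k) g (ofBackgroundC (ιSU N) (T₀ k U.1)) X).re = (functionalC (S' k) g (ofBackgroundC (ιSU N) (T₀ k U.1)) X).re :=
      congrArg Complex.re (functionalC_truncRun_of_le (S' k) g _ X hX)
    have hB : (functionalC (runTowers S' (k + 1)) (prependCoupling b g) (ofBackgroundC (ιSU N) U.1) (pairOfRecord F θ.τ9.M k X)).re =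
        (functionalC (S' (k + 1)) (prependCoupling b g) (ofBackgroundC (ιSU N) U.1) (pairOfRecord F θ.τ9.M k X)).re :=
      congrArg Complex.re (functionalC_truncRun_of_le (S' (k + 1)) _ _ (pairOfRecord F θ.τ9.M k X) (Nat.succ_le_succ hX))
    rw [← hA, ← hB]
    exact H X
  · rcases Nat.lt_or_ge k X.1 with hX | hX
    · have hA : (functionalC (runTowers S' k) g (ofBackgroundC (ιSU N) (T₀ k U.1)) X).re = 0 := by
        rw [show functionalC (runTowers S' k) g (ofBackgroundC (ιSU N) (T₀ k U.1)) X = 0 from functionalC_truncRun_eq_zero (S' k) g _ X hX,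
          Complex.zero_re]
      have hB : (functionalC (runTowers S' (k + 1)) (prependCoupling b g) (ofBackgroundC (ιSU N) U.1) (pairOfRecord F θ.τ9.M k X)).re = 0 := by
        rw [show functionalC (runTowers S' (k + 1)) (prependCoupling b g) (ofBackgroundC (ιSU N) U.1) (pairOfRecord F θ.τ9.M k X) = 0 from
          functionalC_truncRun_eq_zero (S' (k + 1)) _ _ (pairOfRecord F θ.τ9.M k X) (Nat.succ_lt_succ hX), Complex.zero_re]
      rw [hA, hB, sub_zero, abs_zero]
      exact mul_nonneg (mul_nonneg hC₅ (pow_nonneg hθ₅ _)) (Real.exp_nonneg _)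
    · have hA : (functionalC (runTowers S' k) g (ofBackgroundC (ιSU N) (T₀ k U.1)) X).re = (functionalC (S' k) g (ofBackgroundC (ιSU N) (T₀ k U.1)) X).re :=
        congrArg Complex.re (functionalC_truncRun_of_le (S' k) g _ X hX)
      have hB : (functionalC (runTowers S' (k + 1)) (prependCoupling b g) (ofBackgroundC (ιSU N) U.1) (pairOfRecord F θ.τ9.M k X)).re =
          (functionalC (S' (k + 1)) (prependCoupling b g) (ofBackgroundC (ιSU N) U.1) (pairOfRecord F θ.τ9.M k X)).re :=
        congrArg Complex.re (functionalC_truncRun_of_le (S' (k + 1)) _ _ (pairOfRecord F θ.τ9.M k X) (Nat.succ_le_succ hX))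
      rw [hA, hB]
      exact H X hX

end Faces


/-! ## §2 The closed forms at the Stage-13 homes for a reading pinned to the admissible reading at run towers -/

section Pinned

variable (𝔯 : RateReading₁₃ N) (Rg : (F : T4Family) → Stage13Params F N → Prop)
  (S' : (F : T4Family) → (θ : Stage13Params F N) → (k : ℕ) → ClusterTower (F.P k) (MatA N) θ.τ9.M)
  (sp : (F : T4Family) → (θ : Stage13Params F N) → (k j : ℕ) → (domSys (F.P k) θ.τ9.M j).Dom → Set (CPair (F.P k) (MatA N)))
  (gauge : (F : T4Family) → (θ : Stage13Params F N) → (k : ℕ) → GaugeField (F.P k) 0 (Node00.SU N) → GaugeField (F.P k) 0 (Node00.SU N) → ℝ)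
  (hg : ∀ (F : T4Family) (θ : Stage13Params F N) (k : ℕ) (U U' : GaugeField (F.P k) 0 (Node00.SU N)), 0 ≤ gauge F θ k U U')
  (T₀ : (F : T4Family) → (θ : Stage13Params F N) → (k : ℕ) → GaugeField (F.P (k + 1)) 0 (Node00.SU N) → GaugeField (F.P k) 0 (Node00.SU N))
  (hT : ∀ (F : T4Family) (θ : Stage13Params F N) (k : ℕ) (U : GaugeField (F.P (k + 1)) 0 (Node00.SU N)),
    (∀ (j : ℕ) (Y : (domSys (F.P (k + 1)) θ.τ9.M j).Dom), ofBackgroundC (ιSU N) U ∈ sp F θ (k + 1) j Y) →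
      ∀ (j : ℕ) (X : (domSys (F.P k) θ.τ9.M j).Dom), ofBackgroundC (ιSU N) (T₀ F θ k U) ∈ sp F θ k j X)
  (li : (F : T4Family) → Stage13Params F N → LetterInputs)
  (hpin : ∀ (F : T4Family) (θ : Stage13Params F N) (hP : θ.Provisos₁₃ F N) (g₀ : ℕ → ℝ) (os : List (ULoop F)),
    (𝔯.lit F θ hP g₀ os).u3 =
      (ReadingData.ofRecordAdm F θ.τ9.M N (runTowers (S' F θ)) (sp F θ) (gauge F θ) (hg F θ) (T₀ F θ) (hT F θ) (li F θ)).u3Objects θ.γ)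
  (hC₅ : ∀ (F : T4Family) (θ : Stage13Params F N), 0 ≤ (li F θ).C₅) (hθ₅ : ∀ (F : T4Family) (θ : Stage13Params F N), 0 ≤ (li F θ).θ₅)

include hpin hC₅ hθ₅ in
/-- ★ **N18's STATEMENT OF RECORD AT THE STAGE-13 HOME FOR A READING PINNED TO THE ADMISSIBLE READING AT RUN TOWERS = THE CREATION STEPS `j ≤ k` OF THE UNTRUNCATED
TOWERS** [bookkeeping; layer B's `s_N18_rRec₁₃_iff` + `hpin` + §1].  Under the sign letters: `S_N18 (RRec₁₃ 𝔯)` ⇔ for every family `F`, datum of record `D` with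
Stage-13 key `h` (`θ := h.params`), run length `k`, member `b ∈ ]0, θ.γ]`, history `g ∈ ]0, θ.γ]^ℕ`, ADMISSIBLE run-B field `U` of the `(k+1)`-th torus and every
run-A domain `(j, X)` WITH `j ≤ k`: `|Re E^{(j)}_{S′_k}(X; g; (ι(T₀ U), 0)) − Re E^{(j+1)}_{S′_{k+1}}(πX; b∷g; (ιU, 0))| ≤ C₅ · θ₅ ^ j · e^{−κ·d_j(X)}` — `k + 1` levels per
run length.  The ₁₃ twin of module 17 §1 `s_N18_readingAdm₁₂_runTowers_iff`.  NOT PRINTED; NOT proved. [cite: Balaban1987RG1, (0.23)–(0.25) pp.256–257, Thm 1 p.259 and (1.18) p.263; Balaban1988RG2Cluster, (2.13) p.14 and (2.16)–(2.18) p.16] -/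
theorem s_N18_rRec₁₃_readingAdm_runTowers_iff_le_of_pin :
    S_N18 (RRec₁₃ 𝔯) ↔
      ∀ (F : T4Family) (D : Datum F N) (h : IsDatumOfRecord₁₃C F N D) (k : ℕ) (b : ℝ), 0 < b → b ≤ h.params.γ →
        ∀ g ∈ Window h.params.γ,
          ∀ (U : {U : GaugeField (F.P (k + 1)) 0 (Node00.SU N) //
              ∀ (j : ℕ) (Y : (domSys (F.P (k + 1)) h.params.τ9.M j).Dom), ofBackgroundC (ιSU N) U ∈ sp F h.params (k + 1) j Y})
            (X : Node00.W1.Dom (F.P k) h.params.τ9.M), X.1 ≤ k →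
          |(functionalC (S' F h.params k) g (ofBackgroundC (ιSU N) (T₀ F h.params k U.1)) X).re -
              (functionalC (S' F h.params (k + 1)) (prependCoupling b g) (ofBackgroundC (ιSU N) U.1) (pairOfRecord F h.params.τ9.M k X)).re| ≤
            (li F h.params).C₅ * (li F h.params).θ₅ ^ X.1 * Real.exp (-((li F h.params).κ * (domSys (F.P k) h.params.τ9.M X.1).dj X.2)) := by
  rw [s_N18_rRec₁₃_iff]
  constructor
  · intro H F D h k
    have h₁ := H F D h (fun _ => 0) [] k
    rw [hpin] at h₁
    exact (n18At_u3OfRecord₁₃_readingAdm_runTowers_iff_le h.params k (S' F h.params) (sp F h.params) (gauge F h.params) (hg F h.params) (T₀ F h.params)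
      (hT F h.params) (li F h.params) (hC₅ F h.params) (hθ₅ F h.params)).1 h₁
  · intro H F D h g₀ os k
    rw [hpin]
    exact (n18At_u3OfRecord₁₃_readingAdm_runTowers_iff_le h.params k (S' F h.params) (sp F h.params) (gauge F h.params) (hg F h.params) (T₀ F h.params)
      (hT F h.params) (li F h.params) (hC₅ F h.params) (hθ₅ F h.params)).2 (H F D h k)

include hpin hC₅ hθ₅ in
/-- ★ **THE SAME AT THE REGIME-RESTRICTED HOME** [bookkeeping; layer B's `s_N18_rRec₁₃On_iff` + `hpin` + §1]: `S_N18 (RRec₁₃On 𝔯 Rg)` ⇔ the inequality of the previous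
result, asked at every Stage-13 tuple `θ` with `Provisos₁₃` IN `Rg`, admissible (the θ-keyed form of layer B's regime home), every run length `k`, member, history,
admissible run-B field and run-A domain of creation step `j ≤ k`. [cite: Balaban1987RG1, (0.23)–(0.25) pp.256–257, Thm 1 p.259 and (1.18) p.263; Balaban1988RG2Cluster, (2.13) p.14] -/
theorem s_N18_rRec₁₃On_readingAdm_runTowers_iff_le_of_pin :
    S_N18 (RRec₁₃On 𝔯 Rg) ↔
      ∀ (F : T4Family) (θ : Stage13Params F N), θ.Provisos₁₃ F N → Rg F θ → θ.Admissible F N → ∀ (k : ℕ) (b : ℝ), 0 < b → b ≤ θ.γ →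
        ∀ g ∈ Window θ.γ,
          ∀ (U : {U : GaugeField (F.P (k + 1)) 0 (Node00.SU N) // ∀ (j : ℕ) (Y : (domSys (F.P (k + 1)) θ.τ9.M j).Dom), ofBackgroundC (ιSU N) U ∈ sp F θ (k + 1) j Y})
            (X : Node00.W1.Dom (F.P k) θ.τ9.M), X.1 ≤ k →
          |(functionalC (S' F θ k) g (ofBackgroundC (ιSU N) (T₀ F θ k U.1)) X).re -
              (functionalC (S' F θ (k + 1)) (prependCoupling b g) (ofBackgroundC (ιSU N) U.1) (pairOfRecord F θ.τ9.M k X)).re| ≤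
            (li F θ).C₅ * (li F θ).θ₅ ^ X.1 * Real.exp (-((li F θ).κ * (domSys (F.P k) θ.τ9.M X.1).dj X.2)) := by
  rw [s_N18_rRec₁₃On_iff]
  constructor
  · intro H F θ hP hRg hA k
    have h₁ := H F θ hP hRg hA (fun _ => 0) [] k
    rw [hpin] at h₁
    exact (n18At_u3OfRecord₁₃_readingAdm_runTowers_iff_le θ k (S' F θ) (sp F θ) (gauge F θ) (hg F θ) (T₀ F θ) (hT F θ) (li F θ) (hC₅ F θ) (hθ₅ F θ)).1 h₁
  · intro H F θ hP hRg hA g₀ os k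
    rw [hpin]
    exact (n18At_u3OfRecord₁₃_readingAdm_runTowers_iff_le θ k (S' F θ) (sp F θ) (gauge F θ) (hg F θ) (T₀ F θ) (hT F θ) (li F θ) (hC₅ F θ) (hθ₅ F θ)).2
      (H F θ hP hRg hA k)

end Pinned

end YMDAG.N18.W1Reading

end
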